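import Mathlib.NumberTheory.Zsqrtd.Basic
import Mathlib.Data.Nat.Sqrt

/-!
# B-secant classes on a product of two RM abelian surfaces — kernel census (COR-CM, literature seat André-3, gen 6)

COR-CM (cell `pub-hodgecm2`), portfolio pass 2026-08-21, count-neutral; finite, kernel-decided statements only (no
named fact, no geometry, no `sorry`).  Companion of the cell note
`run/shared/lean/pub/pub-hodgecm2/pub-hodgecm2-lit-andre-3/PORTFOLIO-lit-andre-3-g6.md` (ask A6-R8′).

MODEL (dictionary to geometry CITED, not formalised).  `X₀ = S₁ × S₁′`, `S₁ = J(C₁)`, `S₁′ = J(C₁′)` principally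
polarised abelian surfaces with real multiplication by `ℤ[√t]`; `a_i`, `b_i` = the components of `θ₁`, `θ₁′` at the two
real places, so that the divisor-generated even cohomology of `X₀` is the commutative algebra on the sixteen square-free
monomials in `a₁, a₂, b₁, b₂` (`a_i² = b_i² = 0`, `a₁a₂b₁b₂ = [pt]`), with coefficients read at the first real place
(the coefficient of the place-swapped monomial of a rational class is the Galois conjugate); `f·θ₁ = f a₁ + γ(f) a₂`.
Markman's secant space for `(F₀ ↪ End X₀, Θ = θ₁ ⊞ θ₁′, q)`:
`B ⊗ ℝ = P_{σ̂₁}·P_{σ̂₂}`, `P_σ̂ = ⟨1 − (q̂/2)Θ_σ̂², Θ_σ̂⟩`, `Θ_i = a_i + b_i`, i.e. (integrally, `Θ_i² = 2a_ib_i`)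
`B(ℚ) = {r·u₁u₂ + h_B·Θ₁u₂ + γ(h_B)·u₁Θ₂ + x·Θ₁Θ₂}`, `u_i = 1 − q̂_i a_ib_i`
[cite: Markman2025SecantRealMultiplication, §12.1 (pure spinors `ℓ_T = exp(Σ_σ̂ T(σ̂)(√-q) Θ_σ̂)`, `B ⊗ ℝ = ⊗_σ̂ P_σ̂`)];
a `B`-secant sheaf is a coherent sheaf with `ch ∈ B` [cite: Markman2025SecantRealMultiplication, §1.1].
Chern characters used (standard, cited in the note §2 (F1)–(F8)): `ch(𝒪_D) = fθ₁ − N(f)·a₁a₂` for an effective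
divisor `D ∈ |fθ₁|` on `S₁` (`χ(𝒪_D) = −D²/2`), Künneth for `D × D′`, `ch(𝒪_{S₁×pt}) = b₁b₂`, `ch(𝒪_{pt}) = [pt]`,
inclusion–exclusion for generic unions meeting in reduced points, `ch(I_Z(hΘ)) = e^{hΘ}(1 − ch 𝒪_Z)` with
`e^{hΘ} = (1 + hΘ₁ + h²a₁b₁)(1 + γ(h)Θ₂ + γ(h)²a₂b₂)` (integral form; `Θ_i³ = 0`) [folklore].

* §1 `E0` (anchor, `t = 2`): `Z = D×D′ ∪ 4 + 4 fibres`, `[D] = 2θ₁`, `[D′] = 2θ₁′`, twist `h = 1`: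
  `ch(I_Z(Θ)) ∈ B` with `q = 3` (so `K = F₀(√-3)`, biquadratic), no isolated points.
* §2 `E1` (rank 1, `t = 5`, data of the note scaled by `2` to lie in `ℤ[√5]`): `Z =` two crosswise product surfaces
  of classes `(10−4√5)θ₁ × 10θ₁′` and `10θ₁ × (10−4√5)θ₁′`, `200 + 200` fibres, `80000` junction points,
  `71200` isolated points, twist `h = 3 − √5`: `ch ∈ B` with `q = 186 − 74√5`, `N(q) = 16·451 = 16·11·41` — not a
  square, not `5·`square: `K = F₀(√-q)` is a NON-GALOIS quartic CM field (closure `D₄`).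
* §3 `E2` (rank 2, NO isolated points, `t = 2`): `F` with graded pieces `I_{Z₁}(hΘ)`, `I_{Z₂}(hΘ)`,
  `Z₁ = (D_{14} × D′_g) ⊔ 2744 (S₁×pt)`, `Z₂ = (D_g × D′_{14}) ⊔ 2744 (pt×S₁′)`, `g = 98 − 28√2`, `h = 24 − √2`:
  `ch(F) ∈ B` with `r = 2`, `q = 794 − 344√2`, `N(q) = 98²·41` (non-Galois, `D₄`).
* §4 Negative control: two generic translates of `W₂ = Sym²(C₁ ∪₀ C₁′)` (`[W₂]² = 6` junction points) are NOT secant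
  without isolated points, and ARE secant (`q = 1`) with `4` points — the checker discriminates.
* §5 `E3` (rank 2, SMALL, `t = 2`): graded pieces twisted by `±L₁`, `L₁ = (−1+√2)(θ₁ − θ₁′)`, blocks of classes
  `(2∓√2)θ₁ × (2±√2)θ₁′`, `8 + 8` fibres, `8` isolated points: `ch ∈ B` with `r = 2`, `h_B = 0`, `q = 5 − 2√2`, `N(q) = 17`
  (non-Galois, `D₄`); control without the points.

## References
* [Markman2025SecantRealMultiplication] E. Markman, Secant sheaves on abelian n-folds with real multiplication and Weil classes on abelian 2n-folds with complex multiplication, arXiv:2509.23079 (2025), §1.1 (definition of `B`-secant sheaf), §12.1 (the secant space of `(F, Θ, q)`).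

## Provenance
Kernel cost: `decide +kernel` evaluations of a 16-coefficient commutative algebra over `ℤ√t` (`Zsqrtd`), a few
seconds each.  Oracle: exact python `g6/scratch/secant.py`, `certify_examples.py` in
`run/shared/lean/pub/pub-hodgecm2/pub-hodgecm2-lit-andre-3/`.
-/

namespace Summit.HodgeConjecture.CorCM.Census.SecantSheafClasses

/-- A class: its coefficients on the sixteen square-free monomials `a₁^{k₀} a₂^{k₁} b₁^{k₂} b₂^{k₃}`, indexed by the
bitmask `k = k₀ + 2k₁ + 4k₂ + 8k₃`, with coefficients in `ℤ√t` read at the first real place. [folklore] -/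
abbrev Cl (t : ℤ) : Type := Fin 16 → ℤ√t

variable {t : ℤ}

/-- Galois conjugation of `ℤ√t`. [folklore] -/
def conj (c : ℤ√t) : ℤ√t := ⟨c.re, -c.im⟩

/-- The `k`-th coefficient of the product (square-free monomials multiply by disjoint union of exponent sets). [folklore] -/
def mulCoeff (x y : Cl t) (k : Fin 16) : ℤ√t :=
  (List.finRange 16).foldr
    (fun i acc => if i.val &&& k.val = i.val then acc + x i * y ⟨(k.val ^^^ i.val) % 16, Nat.mod_lt _ (by decide)⟩
      else acc) 0

/-- Product of classes. [folklore] -/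
def mul (x y : Cl t) : Cl t := fun k => mulCoeff x y k
/-- Sum of classes. [folklore] -/
def add (x y : Cl t) : Cl t := fun k => x k + y k
/-- Negative of a class. [folklore] -/
def neg (x : Cl t) : Cl t := fun k => -(x k)
/-- Scalar multiple. [folklore] -/
def smul (c : ℤ√t) (x : Cl t) : Cl t := fun k => c * x k
/-- The constant class `c·1`. [folklore] -/
def ofR (c : ℤ√t) : Cl t := fun k => if k.val = 0 then c else 0
/-- A monomial. [folklore] -/
def mono (m : ℕ) : Cl t := fun k => if k.val = m then 1 else 0
/-- `a₁` (bit 0). [folklore] -/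
def a₁ : Cl t := mono 1
/-- `a₂` (bit 1). [folklore] -/
def a₂ : Cl t := mono 2
/-- `b₁` (bit 2). [folklore] -/
def b₁ : Cl t := mono 4
/-- `b₂` (bit 3). [folklore] -/
def b₂ : Cl t := mono 8
/-- `[pt] = a₁a₂b₁b₂`. [folklore] -/
def pt : Cl t := mono 15
/-- `f·θ₁ = f a₁ + γ(f) a₂`. [folklore] -/
def th1 (f : ℤ√t) : Cl t := add (smul f a₁) (smul (conj f) a₂)
/-- `g·θ₁′ = g b₁ + γ(g) b₂`. [folklore] -/
def th1p (g : ℤ√t) : Cl t := add (smul g b₁) (smul (conj g) b₂)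
/-- `N(f) = f·γ(f)` (an integer, as an element of `ℤ√t`). [folklore] -/
def nm (f : ℤ√t) : ℤ√t := f * conj f
/-- `ch(𝒪_D)` for an effective divisor `D ∈ |fθ₁|` on `S₁`, in the ring of `X₀`: `fθ₁ − N(f)·a₁a₂`. [folklore] -/
def chCurve (f : ℤ√t) : Cl t := add (th1 f) (neg (smul (nm f) (mul a₁ a₂)))
/-- `ch(𝒪_{D′})` for `D′ ∈ |gθ₁′|` on `S₁′`: `gθ₁′ − N(g)·b₁b₂`. [folklore] -/
def chCurve' (g : ℤ√t) : Cl t := add (th1p g) (neg (smul (nm g) (mul b₁ b₂)))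
/-- `e^{hΘ} = (1 + hΘ₁ + h² a₁b₁)(1 + γ(h)Θ₂ + γ(h)² a₂b₂)`, `Θ_i = a_i + b_i`. [folklore] -/
def expTheta (h : ℤ√t) : Cl t :=
  mul (add (ofR 1) (add (smul h (add a₁ b₁)) (smul (h * h) (mul a₁ b₁))))
      (add (ofR 1) (add (smul (conj h) (add a₂ b₂)) (smul (conj h * conj h) (mul a₂ b₂))))
/-- `u₁ = 1 − q a₁b₁` (`= 1 − (q̂₁/2)Θ₁²`). [cite: Markman2025SecantRealMultiplication, §12.1] -/
def u₁ (q : ℤ√t) : Cl t := add (ofR 1) (neg (smul q (mul a₁ b₁)))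
/-- `u₂ = 1 − γ(q) a₂b₂`. [cite: Markman2025SecantRealMultiplication, §12.1] -/
def u₂ (q : ℤ√t) : Cl t := add (ofR 1) (neg (smul (conj q) (mul a₂ b₂)))
/-- The rational secant class with `B`-coordinates `(r, h_B, x)` for the parameter `q`:
`r·u₁u₂ + h_B·Θ₁u₂ + γ(h_B)·u₁Θ₂ + x·Θ₁Θ₂`. [cite: Markman2025SecantRealMultiplication, §12.1] -/
def secantClass (q r hB x : ℤ√t) : Cl t :=
  add (smul r (mul (u₁ q) (u₂ q)))
    (add (smul hB (mul (add a₁ b₁) (u₂ q)))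
      (add (smul (conj hB) (mul (u₁ q) (add a₂ b₂))) (smul x (mul (add a₁ b₁) (add a₂ b₂)))))
/-- Boolean coefficientwise equality test. [folklore] -/
def beq (x y : Cl t) : Bool := (List.finRange 16).all fun k => decide (x k = y k)

/-- Soundness of `beq`. [folklore] -/
theorem eq_of_beq {x y : Cl t} (h : beq x y = true) : x = y := by
  funext k
  have hk := List.all_eq_true.1 h k (List.mem_finRange k)
  exact of_decide_eq_true hk

/-! ## §1 E0 — the biquadratic anchor (`t = 2`, `q = 3`) -/

/-- `ch(𝒪_Z)`, `Z = D×D′ ∪ 4 (S₁×pt) ∪ 4 (pt×S₁′)` generic, `[D] = 2θ₁`, `[D′] = 2θ₁′`; `16` junction points. [folklore] -/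
def chOZ_E0 : Cl 2 :=
  add (mul (chCurve ⟨2, 0⟩) (chCurve' ⟨2, 0⟩))
    (add (smul ⟨4, 0⟩ (mul b₁ b₂)) (add (smul ⟨4, 0⟩ (mul a₁ a₂)) (smul ⟨-16, 0⟩ pt)))

/-- **E0.** `ch(I_Z(Θ)) = e^{Θ}(1 − ch 𝒪_Z)` is the secant class with `q = 3`, `r = 1`, `h_B = 1`, `x = -3`.
[cite: Markman2025SecantRealMultiplication, §1.1] -/
theorem e0_secant :
    mul (expTheta (⟨1, 0⟩ : ℤ√2)) (add (ofR 1) (neg chOZ_E0)) = secantClass ⟨3, 0⟩ ⟨1, 0⟩ ⟨1, 0⟩ ⟨-3, 0⟩ :=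
  eq_of_beq (by decide +kernel)

/-! ## §2 E1 — rank 1, non-Galois quartic `K` (`t = 5`, scaled by `2`) -/

/-- `ch(𝒪_Z)` for `E1`: blocks `(10−4√5, 10)`, `(10, 10−4√5)`, `200 + 200` fibres, `−80000` junction points,
`+71200` isolated points. [folklore] -/
def chOZ_E1 : Cl 5 :=
  add (mul (chCurve ⟨10, -4⟩) (chCurve' ⟨10, 0⟩))
    (add (mul (chCurve ⟨10, 0⟩) (chCurve' ⟨10, -4⟩))
      (add (smul ⟨200, 0⟩ (mul b₁ b₂)) (add (smul ⟨200, 0⟩ (mul a₁ a₂)) (smul ⟨-8800, 0⟩ pt))))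

/-- **E1.** `ch(I_Z(hΘ))`, `h = 3 − √5`, is the secant class with `q = 186 − 74√5`, `r = 1`, `h_B = h`, `x = -196`.
[cite: Markman2025SecantRealMultiplication, §1.1] -/
theorem e1_secant :
    mul (expTheta (⟨3, -1⟩ : ℤ√5)) (add (ofR 1) (neg chOZ_E1)) = secantClass ⟨186, -74⟩ ⟨1, 0⟩ ⟨3, -1⟩ ⟨-196, 0⟩ :=
  eq_of_beq (by decide +kernel)

/-- `N(186 − 74√5) = 16·11·41`; `11·41` and `5·11·41` are not squares (so `K = ℚ(√5)(√-q)` is non-Galois). [folklore] -/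
theorem e1_norm : (186 : ℤ) ^ 2 - 5 * 74 ^ 2 = 16 * (11 * 41) ∧ ¬ IsSquare (11 * 41 : ℕ) ∧ ¬ IsSquare (5 * (11 * 41) : ℕ) := by
  refine ⟨by norm_num, ?_, ?_⟩
  · rintro ⟨r, hr⟩; exact Nat.not_exists_sq (m := 21) (n := 11 * 41) (by norm_num) (by norm_num) ⟨r, hr.symm⟩
  · rintro ⟨r, hr⟩; exact Nat.not_exists_sq (m := 47) (n := 5 * (11 * 41)) (by norm_num) (by norm_num) ⟨r, hr.symm⟩

/-! ## §3 E2 — rank 2, no isolated points, non-Galois quartic `K` (`t = 2`) -/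

/-- `ch(𝒪_{Z₁})`, `Z₁ = (D_{14} × D′_g) ⊔ 2744 (S₁×pt)`, `g = 98 − 28√2` (disjoint union). [folklore] -/
def chOZ1_E2 : Cl 2 := add (mul (chCurve ⟨14, 0⟩) (chCurve' ⟨98, -28⟩)) (smul ⟨2744, 0⟩ (mul b₁ b₂))
/-- `ch(𝒪_{Z₂})`, `Z₂ = (D_g × D′_{14}) ⊔ 2744 (pt×S₁′)` (disjoint union). [folklore] -/
def chOZ2_E2 : Cl 2 := add (mul (chCurve ⟨98, -28⟩) (chCurve' ⟨14, 0⟩)) (smul ⟨2744, 0⟩ (mul a₁ a₂))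

/-- **E2.** `e^{hΘ}(2 − ch 𝒪_{Z₁} − ch 𝒪_{Z₂})`, `h = 24 − √2`, is the secant class with `q = 794 − 344√2`, `r = 2`,
`h_B = 2h = 48 − 2√2`, `x = -1596`. [cite: Markman2025SecantRealMultiplication, §1.1] -/
theorem e2_secant :
    mul (expTheta (⟨24, -1⟩ : ℤ√2)) (add (ofR ⟨2, 0⟩) (neg (add chOZ1_E2 chOZ2_E2)))
      = secantClass ⟨794, -344⟩ ⟨2, 0⟩ ⟨48, -2⟩ ⟨-1596, 0⟩ :=
  eq_of_beq (by decide +kernel)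

/-- `N(794 − 344√2) = 98²·41`; `41` and `2·41` are not squares (so `K = ℚ(√2)(√-q)` is non-Galois). [folklore] -/
theorem e2_norm : (794 : ℤ) ^ 2 - 2 * 344 ^ 2 = 98 ^ 2 * 41 ∧ ¬ IsSquare (41 : ℕ) ∧ ¬ IsSquare (2 * 41 : ℕ) := by
  refine ⟨by norm_num, ?_, ?_⟩
  · rintro ⟨r, hr⟩; exact Nat.not_exists_sq (m := 6) (n := 41) (by norm_num) (by norm_num) ⟨r, hr.symm⟩
  · rintro ⟨r, hr⟩; exact Nat.not_exists_sq (m := 9) (n := 2 * 41) (by norm_num) (by norm_num) ⟨r, hr.symm⟩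

/-! ## §4 Negative control — two translates of `W₂` -/

/-- `ch(𝒪_{W₂})`, `W₂ = S₁×0 ∪ C₁×C₁′ ∪ 0×S₁′` by inclusion–exclusion: `[W₂] − Θ₁Θ₂·Θ + 3[pt]`. [folklore] -/
def chOW2 : Cl 2 :=
  add (add (mul b₁ b₂) (add (mul (chCurve ⟨1, 0⟩) (chCurve' ⟨1, 0⟩)) (mul a₁ a₂)))
    (add (neg (mul (chCurve ⟨1, 0⟩) (mul b₁ b₂))) (add (neg (mul (mul a₁ a₂) (chCurve' ⟨1, 0⟩))) (ofR 0)))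

/-- **Control.** Two generic translates of `W₂` (`6` junction points): with `4` isolated points `I_Z(Θ)` is secant
for `q = 1` (`x = -1`); WITHOUT them it is not (same `B`-coordinates). [cite: Markman2025SecantRealMultiplication, §1.1] -/
theorem w2_two_translates :
    mul (expTheta (⟨1, 0⟩ : ℤ√2)) (add (ofR 1) (neg (add (smul ⟨2, 0⟩ chOW2) (smul ⟨-6 + 4, 0⟩ pt))))
        = secantClass ⟨1, 0⟩ ⟨1, 0⟩ ⟨1, 0⟩ ⟨-1, 0⟩ ∧
    beq (mul (expTheta (⟨1, 0⟩ : ℤ√2)) (add (ofR 1) (neg (add (smul ⟨2, 0⟩ chOW2) (smul ⟨-6, 0⟩ pt)))))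
        (secantClass ⟨1, 0⟩ ⟨1, 0⟩ ⟨1, 0⟩ ⟨-1, 0⟩) = false :=
  ⟨eq_of_beq (by decide +kernel), by decide +kernel⟩


/-! ## §5 E3 — rank 2, SMALL, asymmetric twists (`t = 2`; appended 2026-08-21, same seat)

Found by the asymmetric-twist scan of ask A6-R8″(ii) (cell note §0 (4) E3): the two graded pieces are twisted by
OPPOSITE divisors `±L₁`, `L₁ = (−1+√2)θ₁ + (1−√2)θ₁′`, so `c₁(F) = 0` and `ch(F) ∈ B ∩ (H⁰ ⊕ H⁴ ⊕ H⁸) = ⟨u₁u₂, Θ₁Θ₂⟩`. -/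

/-- `e^{αθ₁ + βθ₁′} = (1 + αa₁ + γ(α)a₂ + N(α)a₁a₂)(1 + βb₁ + γ(β)b₂ + N(β)b₁b₂)` (integral form: `(αθ₁)² = 2N(α)a₁a₂`,
`(αθ₁)³ = 0`). [folklore] -/
def expDiv (α β : ℤ√t) : Cl t :=
  mul (add (ofR 1) (add (th1 α) (smul (nm α) (mul a₁ a₂))))
      (add (ofR 1) (add (th1p β) (smul (nm β) (mul b₁ b₂))))

/-- `ch(𝒪_{Z₁})`, `Z₁ = (D_f × D′_{γf}) ⊔ 8 (S₁×pt) ⊔ 4 points`, `f = 2 − √2` (`N(f) = 2`), disjoint union. [folklore] -/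
def chOZ1_E3 : Cl 2 :=
  add (mul (chCurve ⟨2, -1⟩) (chCurve' ⟨2, 1⟩)) (add (smul ⟨8, 0⟩ (mul b₁ b₂)) (smul ⟨4, 0⟩ pt))
/-- `ch(𝒪_{Z₂})`, `Z₂ = (D_{γf} × D′_f) ⊔ 8 (pt×S₁′) ⊔ 4 points`, disjoint union. [folklore] -/
def chOZ2_E3 : Cl 2 :=
  add (mul (chCurve ⟨2, 1⟩) (chCurve' ⟨2, -1⟩)) (add (smul ⟨8, 0⟩ (mul a₁ a₂)) (smul ⟨4, 0⟩ pt))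

/-- **E3.** `e^{L₁}(1 − ch 𝒪_{Z₁}) + e^{−L₁}(1 − ch 𝒪_{Z₂})`, `L₁ = (−1+√2)θ₁ + (1−√2)θ₁′`, is the secant class with
`q = 5 − 2√2`, `r = 2`, `h_B = 0`, `x = −10` (explicitly `2 − 10·Θ₁Θ₂ − (10−4√2)a₁b₁ − (10+4√2)a₂b₂ + 34[pt]`).
[cite: Markman2025SecantRealMultiplication, §1.1] -/
theorem e3_secant :
    add (mul (expDiv (⟨-1, 1⟩ : ℤ√2) ⟨1, -1⟩) (add (ofR 1) (neg chOZ1_E3)))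
        (mul (expDiv (⟨1, -1⟩ : ℤ√2) ⟨-1, 1⟩) (add (ofR 1) (neg chOZ2_E3)))
      = secantClass ⟨5, -2⟩ ⟨2, 0⟩ ⟨0, 0⟩ ⟨-10, 0⟩ :=
  eq_of_beq (by decide +kernel)

/-- `N(5 − 2√2) = 17`; `17` and `2·17` are not squares (so `K = ℚ(√2)(√-q)` is non-Galois, closure `D₄`). [folklore] -/
theorem e3_norm : (5 : ℤ) ^ 2 - 2 * 2 ^ 2 = 17 ∧ ¬ IsSquare (17 : ℕ) ∧ ¬ IsSquare (2 * 17 : ℕ) := by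
  refine ⟨by norm_num, ?_, ?_⟩
  · rintro ⟨r, hr⟩; exact Nat.not_exists_sq (m := 4) (n := 17) (by norm_num) (by norm_num) ⟨r, hr.symm⟩
  · rintro ⟨r, hr⟩; exact Nat.not_exists_sq (m := 5) (n := 2 * 17) (by norm_num) (by norm_num) ⟨r, hr.symm⟩

/-- Without the `8` isolated points the same configuration is NOT secant (control). [cite: Markman2025SecantRealMultiplication, §1.1] -/
theorem e3_control :
    beq (add (mul (expDiv (⟨-1, 1⟩ : ℤ√2) ⟨1, -1⟩) (add (ofR 1) (neg (add chOZ1_E3 (smul ⟨-4, 0⟩ pt)))))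
             (mul (expDiv (⟨1, -1⟩ : ℤ√2) ⟨-1, 1⟩) (add (ofR 1) (neg (add chOZ2_E3 (smul ⟨-4, 0⟩ pt))))))
        (secantClass ⟨5, -2⟩ ⟨2, 0⟩ ⟨0, 0⟩ ⟨-10, 0⟩) = false := by
  decide +kernel

end Summit.HodgeConjecture.CorCM.Census.SecantSheafClasses
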